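import Summits.Ventures.PercRepro.S1CFGSmall
import Mathlib.Combinatorics.Enumerative.DoubleCounting

/-!
# PercRepro — THE DOUBLE COUNT OF THE LOW-RANK `k`-SETS BY THEIR `(k − 1)`-SUBSETS (p1, gen 38)

For a coloop-free finite matroid of nullity `ν` and `1 ≤ s < rank E`, `1 ≤ k`:
**`mul_ncard_le_of_eRk`** — `k · Q_k^s ≤ (s + ν − k) · #{Y : |Y| = k − 1, rk Y = s} + (n − (k − 1)) · Q_{k−1}^{s−1}`,
where `Q_k^s = #{X ⊆ E : |X| = k, rk X ≤ s}`. Proof: count the pairs `(X, Y)` with `Y ⊆ X`, `|Y| = k − 1`, `rk X ≤ s`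
(`Finset.sum_card_bipartiteAbove_eq_sum_card_bipartiteBelow`): every such `X` has exactly `k` such `Y` (all its
`(k − 1)`-subsets have rank `≤ s`); a `Y` of rank exactly `s` extends only inside its closure — `X = Y ∪ {x}` with
`x ∈ cl Y ∖ Y`, and `|cl Y| ≤ s + ν − 1` because `cl Y` is a proper subset (`rk Y < rk E`) of nullity `≤ ν − 1` (the
coloop-free budget (★) of S1CFNullity); a `Y` of rank `< s` extends by any of the `n − (k − 1)` outside points.
The instances `(k, s) = (4, 2), (5, 2), (5, 3)` give the `4`- and `5`-set caps of a simple matroid of nullity `ν` in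
S1CFGSimpleFive (p7's case (IV) of the cell `(13, 9)`). Also **`ncard_family_eq_card_filter`** (set-builder families as
finset filters). Nothing about any cell is claimed. Axioms: standard.
-/

open scoped Matroid

namespace PercRepro

namespace S1CFG

open Set S1CF

variable {α : Type}

/-- A set-builder family of `k`-subsets of `E` with a property `P` is the image of the finset filter. -/
theorem ncard_family_eq_card_filter (M : Matroid α) [M.Finite] (k : ℕ) (P : Set α → Prop)
    [DecidablePred fun X : Finset α => P (X : Set α)] :
    {X : Set α | X ⊆ M.E ∧ X.ncard = k ∧ P X}.ncard =
      ((M.ground_finite.toFinset.powersetCard k).filter (fun X : Finset α => P (X : Set α))).card := by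
  classical
  have hEfin := M.ground_finite
  have himg : {X : Set α | X ⊆ M.E ∧ X.ncard = k ∧ P X} =
      (fun s : Finset α => (s : Set α)) ''
        (((hEfin.toFinset.powersetCard k).filter (fun X : Finset α => P (X : Set α)) : Finset (Finset α)) :
          Set (Finset α)) := by
    ext X
    simp only [Set.mem_setOf_eq, Set.mem_image, Finset.mem_coe, Finset.mem_filter, Finset.mem_powersetCard]
    constructor
    · rintro ⟨hXE, hXk, hPX⟩
      have hXfin : X.Finite := hEfin.subset hXE
      refine ⟨hXfin.toFinset, ⟨⟨?_, ?_⟩, by simpa using hPX⟩, by simp⟩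
      · intro x hx
        rw [Set.Finite.mem_toFinset] at hx ⊢
        exact hXE hx
      · rw [← hXk, Set.ncard_eq_toFinset_card X hXfin]
    · rintro ⟨s, ⟨⟨hsE, hsk⟩, hPs⟩, rfl⟩
      refine ⟨?_, by rw [Set.ncard_coe_finset, hsk], hPs⟩
      intro x hx
      exact (Set.Finite.mem_toFinset hEfin).1 (hsE (Finset.mem_coe.1 hx))
  rw [himg, Set.ncard_image_of_injective _ Finset.coe_injective, Set.ncard_coe_finset]

/-- `rk X ≤ t` (in `ℕ∞`) is `rk X ≤ t` in `ℕ` for `X ⊆ E`. -/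
theorem eRk_le_coe_iff (M : Matroid α) [M.Finite] {X : Set α} (hX : X ⊆ M.E) (t : ℕ) :
    M.eRk X ≤ t ↔ (M.eRk X).toNat ≤ t := by
  rw [← S1.coe_toNat_eRk M hX]
  exact Nat.cast_le

/-- `rk X = t` (in `ℕ∞`) is `rk X = t` in `ℕ` for `X ⊆ E`. -/
theorem eRk_eq_coe_iff (M : Matroid α) [M.Finite] {X : Set α} (hX : X ⊆ M.E) (t : ℕ) :
    M.eRk X = t ↔ (M.eRk X).toNat = t := by
  rw [← S1.coe_toNat_eRk M hX]
  exact Nat.cast_inj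

/-- **A proper closure is small**: for `Y` with `rk Y < rk E`, `|cl Y| + 1 ≤ rk Y + ν` (coloop-free, nullity `ν`). -/
theorem ncard_closure_add_one_le (M : Matroid α) [M.Finite] (hK : ∀ e, ¬ M.IsColoop e) {ν : ℕ}
    (hd : M.E.encard = M.eRank + (ν : ℕ∞)) {Y : Set α}
    (hlt : (M.eRk Y).toNat < (M.eRk M.E).toNat) :
    (M.closure Y).ncard + 1 ≤ (M.eRk Y).toNat + ν := by
  have hcl : M.closure Y ⊆ M.E := M.closure_subset_ground _
  have hne : M.closure Y ≠ M.E := by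
    intro h
    have := M.eRk_closure_eq Y
    rw [h] at this
    rw [this] at hlt
    exact lt_irrefl _ hlt
  have := ncard_add_one_le_eRk_toNat_add_of_ssubset M hd hK hcl hne
  rw [M.eRk_closure_eq] at this
  exact this

/-- **A superset of the same rank lies in the closure**: `Y ⊆ X ⊆ E` and `rk X ≤ rk Y` give `X ⊆ cl Y`. -/
theorem subset_closure_of_eRk_le (M : Matroid α) [M.Finite] {X Y : Set α} (hX : X ⊆ M.E) (hYX : Y ⊆ X)
    (hr : M.eRk X ≤ M.eRk Y) : X ⊆ M.closure Y := by
  intro x hx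
  by_contra hxcl
  have h1 : M.eRk (insert x Y) = M.eRk Y + 1 := Matroid.eRk_insert_eq_add_one ⟨hX hx, hxcl⟩
  have h2 : M.eRk (insert x Y) ≤ M.eRk X := M.eRk_mono (Set.insert_subset hx hYX)
  have hfin : M.eRk Y ≠ ⊤ := (M.isRkFinite_of_finite (M.ground_finite.subset (hYX.trans hX))).eRk_lt_top.ne
  have : M.eRk Y + 1 ≤ M.eRk Y := h1 ▸ h2.trans hr
  exact absurd this (by
    rw [not_le]
    exact ENat.lt_add_one_iff hfin |>.2 le_rfl)

/-- **THE DOUBLE COUNT**: `k · Q_k^s ≤ (s + ν − k) · #{Y : |Y| = k − 1, rk Y = s} + (n − (k − 1)) · Q_{k−1}^{s−1}`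
for a coloop-free matroid of nullity `ν`, `1 ≤ k`, `1 ≤ s < rk E`. -/
theorem mul_ncard_le_of_eRk (M : Matroid α) [M.Finite] (hK : ∀ e, ¬ M.IsColoop e) {ν : ℕ}
    (hd : M.E.encard = M.eRank + (ν : ℕ∞)) {k s : ℕ} (hk : 1 ≤ k) (hs1 : 1 ≤ s)
    (hs : s < (M.eRk M.E).toNat) :
    k * {X : Set α | X ⊆ M.E ∧ X.ncard = k ∧ M.eRk X ≤ s}.ncard ≤
      (s + ν - k) * {Y : Set α | Y ⊆ M.E ∧ Y.ncard = k - 1 ∧ M.eRk Y = s}.ncard +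
        (M.E.ncard - (k - 1)) * {Y : Set α | Y ⊆ M.E ∧ Y.ncard = k - 1 ∧ M.eRk Y ≤ ((s - 1 : ℕ) : ℕ∞)}.ncard := by
  classical
  have hEfin := M.ground_finite
  set E' := hEfin.toFinset with hE'
  have hmemE' : ∀ x, x ∈ E' ↔ x ∈ M.E := fun x => Set.Finite.mem_toFinset hEfin
  have hcoeE' : (E' : Set α) = M.E := Set.Finite.coe_toFinset hEfin
  -- the finset families
  set 𝒳 := (E'.powersetCard k).filter (fun X : Finset α => M.eRk (X : Set α) ≤ s) with h𝒳
  set 𝒴 := (E'.powersetCard (k - 1)).filter (fun Y : Finset α => M.eRk (Y : Set α) ≤ s) with h𝒴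
  have hmem𝒳 : ∀ X, X ∈ 𝒳 ↔ (X : Set α) ⊆ M.E ∧ X.card = k ∧ M.eRk (X : Set α) ≤ s := by
    intro X
    rw [h𝒳, Finset.mem_filter, Finset.mem_powersetCard, ← hcoeE', Finset.coe_subset]
    exact and_assoc
  have hmem𝒴 : ∀ Y, Y ∈ 𝒴 ↔ (Y : Set α) ⊆ M.E ∧ Y.card = k - 1 ∧ M.eRk (Y : Set α) ≤ s := by
    intro Y
    rw [h𝒴, Finset.mem_filter, Finset.mem_powersetCard, ← hcoeE', Finset.coe_subset]
    exact and_assoc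
  -- the conversions
  have hX : {X : Set α | X ⊆ M.E ∧ X.ncard = k ∧ M.eRk X ≤ s}.ncard = 𝒳.card :=
    ncard_family_eq_card_filter M k (fun X => M.eRk X ≤ s)
  have hY1 : {Y : Set α | Y ⊆ M.E ∧ Y.ncard = k - 1 ∧ M.eRk Y = s}.ncard =
      (𝒴.filter (fun Y : Finset α => M.eRk (Y : Set α) = s)).card := by
    rw [ncard_family_eq_card_filter M (k - 1) (fun Y => M.eRk Y = s)]
    congr 1
    ext Y
    simp only [Finset.mem_filter, h𝒴, and_assoc]
    constructor
    · rintro ⟨h1, h2⟩; exact ⟨h1, le_of_eq h2, h2⟩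
    · rintro ⟨h1, -, h3⟩; exact ⟨h1, h3⟩
  have hY2 : {Y : Set α | Y ⊆ M.E ∧ Y.ncard = k - 1 ∧ M.eRk Y ≤ ((s - 1 : ℕ) : ℕ∞)}.ncard =
      (𝒴.filter (fun Y : Finset α => ¬ M.eRk (Y : Set α) = s)).card := by
    rw [ncard_family_eq_card_filter M (k - 1) (fun Y => M.eRk Y ≤ ((s - 1 : ℕ) : ℕ∞))]
    congr 1
    ext Y
    simp only [Finset.mem_filter, h𝒴, and_assoc, Finset.mem_powersetCard]
    have hYE : (Y : Set α) ⊆ M.E ↔ Y ⊆ E' := by rw [← hcoeE', Finset.coe_subset]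
    constructor
    · rintro ⟨h1, h2, h3⟩
      have hYE' : (Y : Set α) ⊆ M.E := by rw [← hcoeE']; exact Finset.coe_subset.2 h1
      rw [eRk_le_coe_iff M hYE'] at h3
      refine ⟨h1, h2, ?_, ?_⟩
      · rw [eRk_le_coe_iff M hYE']; omega
      · rw [eRk_eq_coe_iff M hYE']; omega
    · rintro ⟨h1, h2, h3, h4⟩
      have hYE' : (Y : Set α) ⊆ M.E := by rw [← hcoeE']; exact Finset.coe_subset.2 h1
      rw [eRk_le_coe_iff M hYE'] at h3
      rw [eRk_eq_coe_iff M hYE'] at h4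
      refine ⟨h1, h2, ?_⟩
      rw [eRk_le_coe_iff M hYE']; omega
  rw [hX, hY1, hY2]
  -- the double count over the pairs `Y ⊆ X`
  have key := Finset.sum_card_bipartiteAbove_eq_sum_card_bipartiteBelow (s := 𝒳) (t := 𝒴)
    (fun X Y : Finset α => Y ⊆ X)
  -- left side: every `X` has exactly `k` subsets in `𝒴`
  have hL : ∀ X ∈ 𝒳, (𝒴.bipartiteAbove (fun X Y : Finset α => Y ⊆ X) X).card = k := by
    intro X hX𝒳
    obtain ⟨hXE, hXk, hXr⟩ := (hmem𝒳 X).1 hX𝒳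
    have : 𝒴.bipartiteAbove (fun X Y : Finset α => Y ⊆ X) X = X.powersetCard (k - 1) := by
      ext Y
      rw [Finset.mem_bipartiteAbove, Finset.mem_powersetCard, hmem𝒴]
      constructor
      · rintro ⟨⟨-, hYk, -⟩, hYX⟩; exact ⟨hYX, hYk⟩
      · rintro ⟨hYX, hYk⟩
        refine ⟨⟨(Finset.coe_subset.2 hYX).trans hXE, hYk, ?_⟩, hYX⟩
        exact (M.eRk_mono (Finset.coe_subset.2 hYX)).trans hXr
    rw [this, Finset.card_powersetCard, hXk]
    obtain ⟨k', rfl⟩ : ∃ k', k = k' + 1 := ⟨k - 1, by omega⟩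
    rw [Nat.add_sub_cancel, Nat.choose_succ_self_right]
  -- right side: the fibres
  have hR : ∀ Y ∈ 𝒴, (𝒳.bipartiteBelow (fun X Y : Finset α => Y ⊆ X) Y).card ≤
      if M.eRk (Y : Set α) = s then s + ν - k else M.E.ncard - (k - 1) := by
    intro Y hY𝒴
    obtain ⟨hYE, hYk, hYr⟩ := (hmem𝒴 Y).1 hY𝒴
    have hYfin : (Y : Set α).Finite := Y.finite_toSet
    -- the fibre injects into the singletons outside `Y` (of the closure, or of `E`)
    have hinj : Set.InjOn (fun X : Finset α => X \ Y)
        ((𝒳.bipartiteBelow (fun X Y : Finset α => Y ⊆ X) Y : Finset (Finset α)) : Set (Finset α)) := by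
      intro X hX X' hX' h
      simp only [Finset.mem_coe, Finset.mem_bipartiteBelow] at hX hX'
      simp only at h
      rw [← Finset.union_sdiff_of_subset hX.2, ← Finset.union_sdiff_of_subset hX'.2, h]
    split_ifs with hYs
    · -- `rk Y = s`: `X ⊆ cl Y`, so `X ∖ Y` is a singleton of `cl Y ∖ Y`
      have hclfin : (M.closure (Y : Set α)).Finite := hEfin.subset (M.closure_subset_ground _)
      set T := (hclfin.toFinset \ Y).image (fun x : α => ({x} : Finset α)) with hT
      have hmaps : Set.MapsTo (fun X : Finset α => X \ Y)
          ((𝒳.bipartiteBelow (fun X Y : Finset α => Y ⊆ X) Y : Finset (Finset α)) : Set (Finset α)) (T : Set (Finset α)) := by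
        intro X hX
        simp only [Finset.mem_coe, Finset.mem_bipartiteBelow] at hX
        obtain ⟨hX𝒳, hYX⟩ := hX
        obtain ⟨hXE, hXk, hXr⟩ := (hmem𝒳 X).1 hX𝒳
        have hXcl : (X : Set α) ⊆ M.closure (Y : Set α) :=
          subset_closure_of_eRk_le M hXE (Finset.coe_subset.2 hYX) (hXr.trans (le_of_eq hYs.symm))
        have hcard : (X \ Y).card = 1 := by
          rw [Finset.card_sdiff_of_subset hYX, hXk, hYk]; omega
        obtain ⟨x, hx⟩ := Finset.card_eq_one.1 hcard
        have hxX : x ∈ X \ Y := by rw [hx]; exact Finset.mem_singleton_self x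
        rw [Finset.mem_coe, hT, Finset.mem_image]
        refine ⟨x, ?_, hx.symm⟩
        rw [Finset.mem_sdiff, Set.Finite.mem_toFinset]
        exact ⟨hXcl (Finset.mem_coe.2 (Finset.mem_sdiff.1 hxX).1), (Finset.mem_sdiff.1 hxX).2⟩
      have hTcard : T.card ≤ s + ν - k := by
        rw [hT, Finset.card_image_of_injective _ Finset.singleton_injective]
        have hYcl : Y ⊆ hclfin.toFinset := by
          intro y hy
          rw [Set.Finite.mem_toFinset]
          exact M.subset_closure _ hYE (Finset.mem_coe.2 hy)
        rw [Finset.card_sdiff_of_subset hYcl, hYk]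
        have h1 : hclfin.toFinset.card = (M.closure (Y : Set α)).ncard :=
          (Set.ncard_eq_toFinset_card _ hclfin).symm
        rw [h1]
        have hlt : (M.eRk (Y : Set α)).toNat < (M.eRk M.E).toNat := by
          rw [(eRk_eq_coe_iff M hYE s).1 hYs]; exact hs
        have h2 := ncard_closure_add_one_le M hK hd hlt
        rw [(eRk_eq_coe_iff M hYE s).1 hYs] at h2
        omega
      exact (Finset.card_le_card_of_injOn _ hmaps hinj).trans hTcard
    · -- otherwise `X ∖ Y` is a singleton of `E ∖ Y`
      set T := (E' \ Y).image (fun x : α => ({x} : Finset α)) with hT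
      have hmaps : Set.MapsTo (fun X : Finset α => X \ Y)
          ((𝒳.bipartiteBelow (fun X Y : Finset α => Y ⊆ X) Y : Finset (Finset α)) : Set (Finset α)) (T : Set (Finset α)) := by
        intro X hX
        simp only [Finset.mem_coe, Finset.mem_bipartiteBelow] at hX
        obtain ⟨hX𝒳, hYX⟩ := hX
        obtain ⟨hXE, hXk, hXr⟩ := (hmem𝒳 X).1 hX𝒳
        have hcard : (X \ Y).card = 1 := by
          rw [Finset.card_sdiff_of_subset hYX, hXk, hYk]; omega
        obtain ⟨x, hx⟩ := Finset.card_eq_one.1 hcard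
        have hxX : x ∈ X \ Y := by rw [hx]; exact Finset.mem_singleton_self x
        rw [Finset.mem_coe, hT, Finset.mem_image]
        refine ⟨x, ?_, hx.symm⟩
        rw [Finset.mem_sdiff, hmemE']
        exact ⟨hXE (Finset.mem_coe.2 (Finset.mem_sdiff.1 hxX).1), (Finset.mem_sdiff.1 hxX).2⟩
      have hTcard : T.card ≤ M.E.ncard - (k - 1) := by
        rw [hT, Finset.card_image_of_injective _ Finset.singleton_injective]
        have hYE' : Y ⊆ E' := by
          intro y hy; rw [hmemE']; exact hYE (Finset.mem_coe.2 hy)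
        rw [Finset.card_sdiff_of_subset hYE', hYk]
        have : E'.card = M.E.ncard := (Set.ncard_eq_toFinset_card _ hEfin).symm
        rw [this]
      exact (Finset.card_le_card_of_injOn _ hmaps hinj).trans hTcard
  -- assemble
  have hsumL : (∑ X ∈ 𝒳, (𝒴.bipartiteAbove (fun X Y : Finset α => Y ⊆ X) X).card) = k * 𝒳.card := by
    rw [Finset.sum_congr rfl hL, Finset.sum_const, smul_eq_mul, mul_comm]
  have hsumR : (∑ Y ∈ 𝒴, (𝒳.bipartiteBelow (fun X Y : Finset α => Y ⊆ X) Y).card) ≤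
      (s + ν - k) * (𝒴.filter (fun Y : Finset α => M.eRk (Y : Set α) = s)).card +
        (M.E.ncard - (k - 1)) * (𝒴.filter (fun Y : Finset α => ¬ M.eRk (Y : Set α) = s)).card := by
    calc (∑ Y ∈ 𝒴, (𝒳.bipartiteBelow (fun X Y : Finset α => Y ⊆ X) Y).card)
        ≤ ∑ Y ∈ 𝒴, (if M.eRk (Y : Set α) = s then s + ν - k else M.E.ncard - (k - 1)) :=
          Finset.sum_le_sum hR
      _ = _ := by
          rw [Finset.sum_ite, Finset.sum_const, Finset.sum_const, smul_eq_mul, smul_eq_mul, mul_comm, mul_comm (Finset.card _)]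
  rw [← hsumL, key]
  exact hsumR

end S1CFG

end PercRepro
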